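import Summits.Ventures.QEC.Theorems.BB72DistanceCertificateNoZLogicalBelowSix
import Summits.Ventures.QEC.Theorems.BB72DistanceCertificateWeightSixZLogical
import Summits.Ventures.QEC.Theorems.BB72DistanceCertificateTwelveLogicalQubits
import Summits.Ventures.QEC.Census.BB.BB72.MitmX
import HarnessLib

/-!
# Route BB72DistanceCertificate, item Target (stmt-Ventures-19876): `QC(x³+y+y², y³+x+x²)` on `ℤ₆ × ℤ₆` has
# parameters `[[72, 12, 6]]` — the printed CLAIM of Bravyi et al. 2024 Table 1, row 1, as a kernel-checked theorem

The end of the LADDER-QEC 48-h benchmark pipeline for the bivariate-bicycle code `BB72`: search-3 built the matrices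
(gens `907fb1aa…`); kernel A (qec-search-1, certA `7e943c5a…`, bruteforce) and kernel B (qec-search-2, certB
`1e757ed0…`, CNF/LRAT) certified `d = 6` by different methods; ref-1 re-verified (ROW-SIGNED); qec-search-7 emitted
`BB72.cert : DistCert`; the three route items were closed in the kernel —
`noZLogicalBelowSix_proof` (qec-search-9: meet-in-the-middle replay `mitmZ_ok` by `decide +kernel`, soundness
`CertCheckMitm` over type-10's `CertCheck`), `weightSixZLogical_proof` (qec-type-10: the certificate's weight-6 witness
through `checkStructure`/`upper_sound` and type-05's index bridge), `TwelveLogicalQubits_proof` (qec-type-02: rank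
certificates `r_X = r_Z = 30`). This file applies the route's deciding glue `closes` (lower bound + witness ⇒
`d_Z = 6` by `CSSCode.dZ_eq_of_witness`; `d = d_Z` by Lemma 1; `n = 72` by counting) and records the consequences
for the typed code and for the certificate literal (census row of record: `d_Z = d_X = 6` on `BB72.cert`).
Tier KERNEL throughout: axioms `propext`, `Classical.choice`, `Quot.sound`; no `native_decide` in the import cone.
-/

namespace Summit.Ventures.QEC.Census.BB72

open Literature.InformationTheory.QuantumCodes Summit.Ventures.QEC.BB
  Summit.Ventures.QEC.Theses.BB72DistanceCertificate

/-- **Item Assembly holds outright**: the route's glue `closes` is a proof of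
`NoZLogicalBelowSix → WeightSixZLogical → TwelveLogicalQubits → BB72_12_6_claim`. -/
theorem assembly_proof : Summit.Ventures.QEC.Theses.BB72DistanceCertificate.Assembly :=
  fun hL hU hK => closes hL hU hK

/-- **Item Target, PROVED — `[[72, 12, 6]]` CERTIFIED**: `HasParams BB.bb72 72 12 6`, from the three closed items. -/
theorem target_proof : Summit.Ventures.QEC.Theses.BB72DistanceCertificate.Target :=
  closes Summit.Ventures.QEC.Theorems.noZLogicalBelowSix_proof weightSixZLogical_proof
    Summit.Ventures.QEC.Theorems.TwelveLogicalQubits_proof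

/-- **The registered CLAIM leaf discharged**: `Summit.Ventures.QEC.BB.BB72_12_6_claim` (rung Q2 of LADDER-QEC). -/
theorem BB72_12_6_claim_holds : Summit.Ventures.QEC.BB.BB72_12_6_claim := target_proof

/-- `d_Z(BB.bb72) = 6` — CERTIFIED. -/
theorem bb72_dZ : BB.bb72.css.dZ = 6 := (dX_eq_of_hasParams BB72_12_6_claim_holds).2

/-- `d_X(BB.bb72) = 6` — CERTIFIED (`d_X = d = d_Z`, Lemma 1). -/
theorem bb72_dX : BB.bb72.css.dX = 6 := (dX_eq_of_hasParams BB72_12_6_claim_holds).1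

/-- `d(BB.bb72) = min (d_X, d_Z) = 6` — CERTIFIED. -/
theorem bb72_d : BB.bb72.d = 6 := BB72_12_6_claim_holds.2.2

/-! ## The census row of record on the certificate literal (`BB72.cert`, certA `7e943c5a…`) -/

/-- `d_Z = 6` for the certificate's own code `cert.code _` (check matrices `rowMatrix 72 cert.HX/HZ`): structural
check + kernel meet-in-the-middle replay of the `Z` side (`mitmZ_ok`). -/
theorem dZ_cert : (cert.code (cert.commOK_of_checkStructure structure_ok')).dZ = 6 :=
  cert.dZ_code_of_mitm structure_ok' mitmZ_ok

/-- `d_X = 6` for the certificate's own code: structural check + kernel replay of the `X` side (`mitmX_ok`) — the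
second side, not needed for the claim (`d_X = d_Z` is a theorem) but replayed independently. -/
theorem dX_cert : (cert.code (cert.commOK_of_checkStructure structure_ok')).dX = 6 :=
  cert.dX_code_of_mitm structure_ok' mitmX_ok

end Summit.Ventures.QEC.Census.BB72
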